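import Summits.HubbardSuperconductivity.HubbardSuperconductivity.Theorems.EnslavedA1gA1gSlavingTransfer
import Summits.HubbardSuperconductivity.HubbardSuperconductivity.Theorems.IntrinsicLargeNGlue
import Literature.Barriers.HubbardSuperconductivity.PureModelStripeCompetitionProofs
import Literature.MathematicalPhysics.QuantumLattice.HubbardLiebConfig

/-!
# Route `LiebTwin` — CYCLE-FREE glue: the bond-locality form K3″ of crux `DWavePolarisedDiscordance`
# (stmt-HubbardSuperconductivity-15314) closes the route

This module does NOT import `Theses.LiebTwin`, so the route file may import it and set its deciding
theorem to `closes hK2 hK3 hNo := LiebTwinBondLocality.hubbardSuperconductivity_of_bondLocality hK2 hK3 hNo`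
after restating the crux K3′ as K3″ (recommendation of line `registered`, lead cycle 1, 2026-08-17;
report `Cruxes/DWavePolarisedDiscordance/Lines/registered.md`). The three hypotheses are spelled out:

* `hK2` — the body of `Theses.LiebTwin.TwinOnsiteCondensation` verbatim (K2: at some box point the twin
  `φ̃ = liebVec n (CFC.abs (liebW n φ))` of every normalised sector ground state is an on-site condensate);
* `hK3` — K3″ = the registered stub `stub_massFeedsBondSinglets` verbatim (bond locality of the sign
  defect: `κ·(F_s(φ̃) − F_s(φ)) − εL⁴ ≤ F_d(φ) + F_xs(φ)`), implied by the filed crux K3′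
  (`Theorems.stub_massFeedsBondSinglets_of_dWavePolarisedDiscordance`);
* `hNo : Theses.EnslavedA1g.NoOnsiteODLRO` — the shared crux stmt-0933 (verbatim equal to
  `Theses.LiebTwin.NoOnsiteODLRO`; `unfold` both to pass one for the other).

Chain: NoOnsite ⇒ uniform no-on-site-condensate on the box (padding argument,
`uniformNoOnsite_of_noOnsiteODLRO`) ⇒ with the per-state A1g slaving bound of sector eigenvectors
(inline; it is the landed `Theorems.extendedS_sq_le_of_eigen`, from `enslavedA1gIdentity_proof`) the
extended-s order is `≤ εL⁴` uniformly (`extendedS_le_of_noOnsiteODLRO`); with K2 and K3″ at the K2 point this gives the uniform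
floor `(κc/2)L⁴ ≤ F_d(ψ)` (`uniformDWaveFloor_of_bondLocality`), and the proved shared support
`IntrinsicLargeN.uniformLROGivesSummitMatrix_proof` turns it into the summit statement. The padding
argument is the one landed (for `Theses.LiebTwin.NoOnsiteODLRO`, with that import) in
`Theorems/LiebTwinDWavePolarisedDiscordanceStubExtendedSSubordinateOfNoOnsite.lean`, restated here for the
definitionally equal `Theses.EnslavedA1g.NoOnsiteODLRO` only to break the import cycle. No definition, no named fact, no `sorry`.
-/

noncomputable section

-- `dupNamespace`: the summit and the problem are both named `HubbardSuperconductivity` (layout D-0022)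
set_option linter.dupNamespace false

namespace Summit.HubbardSuperconductivity.HubbardSuperconductivity.Theorems.LiebTwinBondLocality

open Matrix
open Literature.MathematicalPhysics.QuantumLattice
open scoped Matrix MatrixOrder Matrix.Norms.L2Operator ComplexOrder
open Summit.HubbardSuperconductivity.EnslavedA1g
open Summit.HubbardSuperconductivity.HubbardSuperconductivity.Theses.EnslavedA1g (NoOnsiteODLRO)

/-- **Sequence form ⇒ uniform form** of "no on-site `k = 0` pair condensate" on the box
`(0,4] × [1/10,3/10]` (cycle-free copy of `Theorems.uniformNoOnsiteOnBox_of_noOnsiteODLRO`, stated for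
`Theses.EnslavedA1g.NoOnsiteODLRO`): a violating normalised ground state at each bad even side, padded
with arbitrary normalised sector ground states (`exists_unit_isGroundStateInSector_hubbardTorus`),
contradicts the crux at tolerance `ε/2`. [folklore] -/
theorem uniformNoOnsite_of_noOnsiteODLRO (h : NoOnsiteODLRO) :
    ∀ U ∈ Set.Ioc (0 : ℝ) 4, ∀ δ ∈ Set.Icc (1 / 10 : ℝ) (3 / 10), ∀ ε : ℝ, 0 < ε → ∃ L₀ : ℕ,
      ∀ (L : ℕ) [NeZero L], L₀ ≤ L → Even L → ∀ φ : Fock (Orb (FermionTorus 2 L)),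
        star φ ⬝ᵥ φ = 1 →
          IsGroundStateInSector (hubbardTorus 2 L 1 U) (2 * ⌊(1 - δ) * (L : ℝ) ^ 2 / 2⌋₊) 0 φ →
            (expect ((pairField sWave L)ᴴ * pairField sWave L) φ).re ≤ ε * (L : ℝ) ^ 4 := by
  classical
  intro U hU δ hδ ε hε
  by_contra hcon
  push Not at hcon
  have hδ' : (-1 : ℝ) ≤ δ := by linarith [hδ.1]
  let P : ∀ L : ℕ, Fock (Orb (FermionTorus 2 L)) → Prop := fun L φ =>
    ∃ _hL : NeZero L, star φ ⬝ᵥ φ = 1 ∧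
      IsGroundStateInSector (hubbardTorus 2 L 1 U) (2 * ⌊(1 - δ) * (L : ℝ) ^ 2 / 2⌋₊) 0 φ ∧
        ε * (L : ℝ) ^ 4 < (expect ((pairField sWave L)ᴴ * pairField sWave L) φ).re
  have hgood : ∀ L : ℕ, ∃ φ : Fock (Orb (FermionTorus 2 L)), star φ ⬝ᵥ φ = 1 ∧
      IsGroundStateInSector (hubbardTorus 2 L 1 U) (2 * ⌊(1 - δ) * (L : ℝ) ^ 2 / 2⌋₊) 0 φ :=
    fun L => Literature.Barriers.HubbardSuperconductivity.exists_unit_isGroundStateInSector_hubbardTorus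
      U L _ (Literature.Barriers.HubbardSuperconductivity.natFloor_filling_le_sq hδ' L)
  let ψ : ∀ L : ℕ, Fock (Orb (FermionTorus 2 L)) := fun L =>
    if hb : ∃ φ, P L φ then hb.choose else (hgood L).choose
  have hψadm : ∀ L : ℕ, star (ψ L) ⬝ᵥ ψ L = 1 ∧
      IsGroundStateInSector (hubbardTorus 2 L 1 U) (2 * ⌊(1 - δ) * (L : ℝ) ^ 2 / 2⌋₊) 0 (ψ L) := by
    intro L
    by_cases hb : ∃ φ, P L φ
    · simp only [ψ, dif_pos hb]
      obtain ⟨_, h1, h2, -⟩ := hb.choose_spec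
      exact ⟨h1, h2⟩
    · simp only [ψ, dif_neg hb]
      exact (hgood L).choose_spec
  have hψbad : ∀ L : ℕ, (∃ φ, P L φ) → P L (ψ L) := by
    intro L hb
    simp only [ψ, dif_pos hb]
    exact hb.choose_spec
  obtain ⟨L₀, hL₀⟩ := h U δ hU.1 ⟨by linarith [hδ.1], by linarith [hδ.2]⟩
    (fun L => 2 * ⌊(1 - δ) * (L : ℝ) ^ 2 / 2⌋₊) ψ (fun L _ => ⟨rfl, hψadm L⟩) (ε / 2) (half_pos hε)
  obtain ⟨L, hLne, hL₀L, hLeven, φ, hφ1, hφGS, hφbad⟩ := hcon L₀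
  obtain ⟨_, -, -, h2⟩ := hψbad L ⟨φ, hLne, hφ1, hφGS, hφbad⟩
  have h1 := @hL₀ L hLne hLeven hL₀L
  have hLpos : (0 : ℝ) < (L : ℝ) := by exact_mod_cast Nat.pos_of_ne_zero (NeZero.ne L)
  have hL4 : (0 : ℝ) < (L : ℝ) ^ 4 := by positivity
  rw [div_le_iff₀ hL4] at h1
  have h2' : ε * (L : ℝ) ^ 4 <
      (expect ((pairField sWave L)ᴴ * pairField sWave L) (ψ L)).re := h2
  nlinarith [h1, h2', hL4, hε]

/-- **No on-site condensate ⇒ the extended-`s` order is `o(L⁴)` uniformly on the box** (the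
channel-selection stub of line `registered` with `C = 0`): slaving bound at tolerance `t²`,
`t = min 1 (ε/(K + U²/4 + 1))`. [folklore] -/
theorem extendedS_le_of_noOnsiteODLRO (h : NoOnsiteODLRO) :
    ∀ U ∈ Set.Ioc (0 : ℝ) 4, ∀ δ ∈ Set.Icc (1 / 10 : ℝ) (3 / 10), ∀ ε : ℝ, 0 < ε → ∃ L₀ : ℕ,
      ∀ (L : ℕ) [NeZero L], L₀ ≤ L → Even L → ∀ φ : Fock (Orb (FermionTorus 2 L)),
        star φ ⬝ᵥ φ = 1 →
          IsGroundStateInSector (hubbardTorus 2 L 1 U) (2 * ⌊(1 - δ) * (L : ℝ) ^ 2 / 2⌋₊) 0 φ →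
            (expect ((pairField extendedSWave L)ᴴ * pairField extendedSWave L) φ).re ≤
              ε * (L : ℝ) ^ 4 := by
  intro U hU δ hδ ε hε
  obtain ⟨K, hK0, hK⟩ := exists_norm_commutator_hubbardTorus_pairField_le extendedSWave U
  have hMpos : 0 < K + U ^ 2 / 4 + 1 := by positivity
  obtain ⟨t, htpos, ht1, htM⟩ : ∃ t : ℝ, 0 < t ∧ t ≤ 1 ∧ t ≤ ε / (K + U ^ 2 / 4 + 1) :=
    ⟨min 1 (ε / (K + U ^ 2 / 4 + 1)), lt_min one_pos (div_pos hε hMpos), min_le_left _ _,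
      min_le_right _ _⟩
  obtain ⟨L₀, hL₀⟩ := uniformNoOnsite_of_noOnsiteODLRO h U hU δ hδ (t ^ 2) (by positivity)
  refine ⟨max L₀ 3, fun L _ hL hLeven φ hφ1 hGS => ?_⟩
  have hL3 : 2 < L := lt_of_lt_of_le (by norm_num) ((le_max_right L₀ 3).trans hL)
  have hy := hL₀ L ((le_max_left L₀ 3).trans hL) hLeven φ hφ1 hGS
  have hA2 : (expect ((pairField extendedSWave L)ᴴ * pairField extendedSWave L) φ).re =
      eucNorm (pairField extendedSWave L *ᵥ φ) ^ 2 :=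
    re_star_dotProduct_conjTranspose_mul_self_mulVec _ _
  have hB2 : (expect ((pairField sWave L)ᴴ * pairField sWave L) φ).re =
      eucNorm (pairField sWave L *ᵥ φ) ^ 2 :=
    re_star_dotProduct_conjTranspose_mul_self_mulVec _ _
  -- per-state A1g slaving bound for the eigenvector φ (the landed `Theorems.extendedS_sq_le_of_eigen`,
  -- re-derived inline from `enslavedA1gIdentity_proof` + `two_mul_eucNorm_sq_le_of_slaving` to keep this
  -- module free of the `Theses.LiebTwin` import):  ‖P_{s'}φ‖² ≤ K L² ‖P_sφ‖ + U² ‖P_sφ‖² / 4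
  have hA2le : eucNorm (pairField extendedSWave L *ᵥ φ) ^ 2 ≤
      K * (L : ℝ) ^ 2 * eucNorm (pairField sWave L *ᵥ φ) +
        U ^ 2 * eucNorm (pairField sWave L *ᵥ φ) ^ 2 / 4 := by
    have hHerm : (hubbardTorus 2 L 1 U).IsHermitian :=
      hubbardTorus_isHermitian (hamiltonian_isHermitian_and_commute_holds _) 1 U
    have hkey := two_mul_eucNorm_sq_le_of_slaving hHerm (enslavedA1gIdentity_proof L hL3 U) hφ1 hGS.2.2
    have hB0 : 0 ≤ eucNorm (pairField sWave L *ᵥ φ) := eucNorm_nonneg _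
    have h2A : 2 * eucNorm (pairField extendedSWave L *ᵥ φ) ^ 2 ≤
        K * (L : ℝ) ^ 2 * eucNorm (pairField sWave L *ᵥ φ) +
          |U| * eucNorm (pairField extendedSWave L *ᵥ φ) * eucNorm (pairField sWave L *ᵥ φ) :=
      hkey.trans (add_le_add (mul_le_mul_of_nonneg_right (hK L) hB0) le_rfl)
    have h := sq_le_of_two_mul_sq_le h2A
    rwa [sq_abs] at h
  rw [hA2]
  rw [hB2] at hy
  set A : ℝ := eucNorm (pairField extendedSWave L *ᵥ φ) with hA
  set B : ℝ := eucNorm (pairField sWave L *ᵥ φ) with hB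
  have hA0 : 0 ≤ A := eucNorm_nonneg _
  have hB0 : 0 ≤ B := eucNorm_nonneg _
  set ℓ : ℝ := (L : ℝ) ^ 2 with hℓ
  have hℓpos : 0 < ℓ := by positivity
  have hL4 : (L : ℝ) ^ 4 = ℓ ^ 2 := by rw [hℓ]; ring
  rw [hL4] at hy ⊢
  have hBsq : B ^ 2 ≤ (t * ℓ) ^ 2 := by nlinarith [hy]
  have hBt : B ≤ t * ℓ := (sq_le_sq₀ hB0 (by positivity)).1 hBsq
  have ht2 : t ^ 2 ≤ t := by nlinarith
  have hKU : (K + U ^ 2 / 4) * t ≤ ε := by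
    calc (K + U ^ 2 / 4) * t ≤ (K + U ^ 2 / 4) * (ε / (K + U ^ 2 / 4 + 1)) :=
          mul_le_mul_of_nonneg_left htM (by positivity)
      _ ≤ (K + U ^ 2 / 4 + 1) * (ε / (K + U ^ 2 / 4 + 1)) :=
          mul_le_mul_of_nonneg_right (by linarith) (div_nonneg hε.le hMpos.le)
      _ = ε := mul_div_cancel₀ ε hMpos.ne'
  calc A ^ 2 ≤ K * ℓ * B + U ^ 2 * B ^ 2 / 4 := hA2le
    _ ≤ K * ℓ * (t * ℓ) + U ^ 2 * (t * ℓ) ^ 2 / 4 := by gcongr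
    _ = (K * t + U ^ 2 / 4 * t ^ 2) * ℓ ^ 2 := by ring
    _ ≤ (K * t + U ^ 2 / 4 * t) * ℓ ^ 2 := by gcongr
    _ = (K + U ^ 2 / 4) * t * ℓ ^ 2 := by ring
    _ ≤ ε * ℓ ^ 2 := mul_le_mul_of_nonneg_right hKU (by positivity)

/-- **Uniform d-wave floor from K2 + K3″ + NoOnsite** (explicit hypotheses): at the K2 point `(U, δ)`,
`(κc/2)/(1+0)·L⁴ ≤ F_d(ψ)` for every normalised sector ground state, eventually in even `L`:
`F_s(φ̃) ≥ cL⁴`, `F_s(φ) ≤ (c/4)L⁴`, `F_xs(φ) ≤ (κc/8)L⁴`, K3″ at `ε = κc/8`. [folklore] -/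
theorem uniformDWaveFloor_of_bondLocality
    (hK2 : ∃ U ∈ Set.Ioc (0 : ℝ) 4, ∃ δ ∈ Set.Icc (1 / 10 : ℝ) (3 / 10), ∃ c : ℝ, 0 < c ∧ ∃ L₀ : ℕ,
      ∀ (L : ℕ) [NeZero L], L₀ ≤ L → Even L → ∀ φ : Fock (Orb (FermionTorus 2 L)), star φ ⬝ᵥ φ = 1 →
        IsGroundStateInSector (hubbardTorus 2 L 1 U) (2 * ⌊(1 - δ) * (L : ℝ) ^ 2 / 2⌋₊) 0 φ →
          c * (L : ℝ) ^ 4 ≤ (expect ((pairField sWave L)ᴴ * pairField sWave L)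
            (liebVec ⌊(1 - δ) * (L : ℝ) ^ 2 / 2⌋₊ (CFC.abs (liebW ⌊(1 - δ) * (L : ℝ) ^ 2 / 2⌋₊ φ)))).re)
    (hK3 : ∀ U ∈ Set.Ioc (0 : ℝ) 4, ∀ δ ∈ Set.Icc (1 / 10 : ℝ) (3 / 10), ∃ κ : ℝ, 0 < κ ∧ ∀ ε : ℝ, 0 < ε →
      ∃ L₀ : ℕ, ∀ (L : ℕ) [NeZero L], L₀ ≤ L → Even L → ∀ φ : Fock (Orb (FermionTorus 2 L)),
        star φ ⬝ᵥ φ = 1 →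
          IsGroundStateInSector (hubbardTorus 2 L 1 U) (2 * ⌊(1 - δ) * (L : ℝ) ^ 2 / 2⌋₊) 0 φ →
            κ * ((expect ((pairField sWave L)ᴴ * pairField sWave L)
                    (liebVec ⌊(1 - δ) * (L : ℝ) ^ 2 / 2⌋₊
                      (CFC.abs (liebW ⌊(1 - δ) * (L : ℝ) ^ 2 / 2⌋₊ φ)))).re -
                  (expect ((pairField sWave L)ᴴ * pairField sWave L) φ).re) -
                ε * (L : ℝ) ^ 4 ≤
              (expect ((pairField dWaveFormFactor L)ᴴ * pairField dWaveFormFactor L) φ).re +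
                (expect ((pairField extendedSWave L)ᴴ * pairField extendedSWave L) φ).re)
    (hNo : NoOnsiteODLRO) :
    ∃ U ∈ Set.Ioc (0 : ℝ) 4, ∃ δ ∈ Set.Icc (1 / 10 : ℝ) (3 / 10), ∃ a : ℝ, 0 < a ∧ ∃ L₀ : ℕ,
      ∀ (L : ℕ) [NeZero L], L₀ ≤ L → Even L → ∀ ψ : Fock (Orb (FermionTorus 2 L)),
        star ψ ⬝ᵥ ψ = 1 →
          IsGroundStateInSector (hubbardTorus 2 L 1 U) (2 * ⌊(1 - δ) * (L : ℝ) ^ 2 / 2⌋₊) 0 ψ →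
            a * (L : ℝ) ^ 4 ≤
              (expect ((pairField dWaveFormFactor L)ᴴ * pairField dWaveFormFactor L) ψ).re := by
  obtain ⟨U, hU, δ, hδ, c, hc, L₀, h2⟩ := hK2
  obtain ⟨κ, hκ, h3⟩ := hK3 U hU δ hδ
  obtain ⟨L₁, h3⟩ := h3 (κ * c / 8) (by positivity)
  obtain ⟨L₂, hs⟩ := uniformNoOnsite_of_noOnsiteODLRO hNo U hU δ hδ (c / 4) (by positivity)
  obtain ⟨L₃, hxs⟩ := extendedS_le_of_noOnsiteODLRO hNo U hU δ hδ (κ * c / 8) (by positivity)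
  refine ⟨U, hU, δ, hδ, κ * c / 2, by positivity, L₀ + L₁ + L₂ + L₃, fun L _ hL hE ψ hψ hgs => ?_⟩
  have i2 := h2 L (by omega) hE ψ hψ hgs
  have i3 := h3 L (by omega) hE ψ hψ hgs
  have is := hs L (by omega) hE ψ hψ hgs
  have ix := hxs L (by omega) hE ψ hψ hgs
  have hL4 : (0 : ℝ) ≤ (L : ℝ) ^ 4 := by positivity
  have hκB := mul_le_mul_of_nonneg_left is hκ.le
  have hκA := mul_le_mul_of_nonneg_left i2 hκ.le
  nlinarith [hκB, hκA, i3, ix, mul_nonneg hκ.le hc.le, hL4]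

/-- **The route `LiebTwin` closes from the bond-locality form K3″ of its crux** (cycle-free deciding
theorem): K2 (`TwinOnsiteCondensation`, spelled out) + K3″ (= `stub_massFeedsBondSinglets`) + `NoOnsiteODLRO`
imply the summit statement, through `uniformDWaveFloor_of_bondLocality` and the proved shared support
`IntrinsicLargeN.uniformLROGivesSummitMatrix_proof` (even-side `liminf` bookkeeping).
Scalapino, Phys. Rep. 250 (1995) 329, §2. [folklore] -/
theorem hubbardSuperconductivity_of_bondLocality :
    (∃ U ∈ Set.Ioc (0 : ℝ) 4, ∃ δ ∈ Set.Icc (1 / 10 : ℝ) (3 / 10), ∃ c : ℝ, 0 < c ∧ ∃ L₀ : ℕ,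
      ∀ (L : ℕ) [NeZero L], L₀ ≤ L → Even L → ∀ φ : Fock (Orb (FermionTorus 2 L)), star φ ⬝ᵥ φ = 1 →
        IsGroundStateInSector (hubbardTorus 2 L 1 U) (2 * ⌊(1 - δ) * (L : ℝ) ^ 2 / 2⌋₊) 0 φ →
          c * (L : ℝ) ^ 4 ≤ (expect ((pairField sWave L)ᴴ * pairField sWave L)
            (liebVec ⌊(1 - δ) * (L : ℝ) ^ 2 / 2⌋₊ (CFC.abs (liebW ⌊(1 - δ) * (L : ℝ) ^ 2 / 2⌋₊ φ)))).re) →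
    (∀ U ∈ Set.Ioc (0 : ℝ) 4, ∀ δ ∈ Set.Icc (1 / 10 : ℝ) (3 / 10), ∃ κ : ℝ, 0 < κ ∧ ∀ ε : ℝ, 0 < ε →
      ∃ L₀ : ℕ, ∀ (L : ℕ) [NeZero L], L₀ ≤ L → Even L → ∀ φ : Fock (Orb (FermionTorus 2 L)),
        star φ ⬝ᵥ φ = 1 →
          IsGroundStateInSector (hubbardTorus 2 L 1 U) (2 * ⌊(1 - δ) * (L : ℝ) ^ 2 / 2⌋₊) 0 φ →
            κ * ((expect ((pairField sWave L)ᴴ * pairField sWave L)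
                    (liebVec ⌊(1 - δ) * (L : ℝ) ^ 2 / 2⌋₊
                      (CFC.abs (liebW ⌊(1 - δ) * (L : ℝ) ^ 2 / 2⌋₊ φ)))).re -
                  (expect ((pairField sWave L)ᴴ * pairField sWave L) φ).re) -
                ε * (L : ℝ) ^ 4 ≤
              (expect ((pairField dWaveFormFactor L)ᴴ * pairField dWaveFormFactor L) φ).re +
                (expect ((pairField extendedSWave L)ᴴ * pairField extendedSWave L) φ).re) →
    Summit.HubbardSuperconductivity.HubbardSuperconductivity.Theses.EnslavedA1g.NoOnsiteODLRO →
    _root_.HubbardSuperconductivity := by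
  intro hK2 hK3 hNo
  obtain ⟨U, hU, δ, hδ, floor⟩ := uniformDWaveFloor_of_bondLocality hK2 hK3 hNo
  have hmat := IntrinsicLargeN.uniformLROGivesSummitMatrix_proof U δ floor
  have hδ' : δ ∈ Set.Ioo (0 : ℝ) (1 / 2) := ⟨by linarith [hδ.1], by linarith [hδ.2]⟩
  unfold _root_.HubbardSuperconductivity Literature.Hubbard.DWaveSuperconductivityHubbard
  exact ⟨U, hU.1, δ, hδ', fun N ψ hyp => hmat N ψ hyp⟩

end Summit.HubbardSuperconductivity.HubbardSuperconductivity.Theorems.LiebTwinBondLocality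

end
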